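import Summits.Ventures.DiscreteObjects.PP12.OrderElevenTriangleKernel
import Summits.Ventures.DiscreteObjects.PP12.OrderElevenTriangleRowCode
import Summits.Ventures.DiscreteObjects.PP12.OrderElevenTriangleSymmetry
import Summits.Ventures.DiscreteObjects.PP12.OrderElevenTrianglePhiWalk

/-!
# PP(12), order-11 cell, Case B (`NoTriangleData12`): SOUNDNESS of the φ side — generator bridge, word action, table and φ-walker (designs g23)
Framing: lottery ticket; floor = certified bounds/negative ranges.

Cell pub-namedobj (venture DiscreteObjects), target (M). Links the packed generators of `OrderElevenTriangleKernel` to the validity-preserving maps of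
`OrderElevenTriangleSymmetry`:

* `packPhi_relabel / packPhi_scale / packPhi_swap12 / packPhi_swap01`: `packPhi (X D).phi = actX (packPhi D.phi)`;
* `applyWD` — the word action on data; `applyWD_valid`, `applyWD_phi_zero`, `packPhi_applyWD : packPhi (applyWD w D f).phi = applyW w (packPhi D.phi) f`;
* `tabOK_sound` — an entry of a checked table slice maps its `φ` to `reps[k]`; `packPhi_ne_zero` — an injective map does not pack to `0`.
The φ-walker's completeness is in `OrderElevenTrianglePhiWalk`; the orbit reduction is assembled in `OrderElevenTriangleNoData`.

Proofs only; nothing here asserts a census statement. No `sorry`, no new axioms.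
(designs g24: `val_sub11` now comes from `OrderElevenTrianglePhiWalk` (`val_sub11'`), whose copy landed first — the gate's dedup lint
bounced the duplicate in the first filing p390435.)
-/

set_option maxRecDepth 100000

namespace Summit.Ventures.DiscreteObjects.PP12

namespace Triangle12

open Function
open Fin.CommRing -- `Fin 11` as a commutative ring (scoped Mathlib instance): cyclic residue arithmetic

/-! ### hex digits -/

/-- bit semantics of `packF` for small values -/
theorem testBit_packF (f : ℕ → ℕ) (hf : ∀ t, f t < 16) (c p : ℕ) :
    (packF f c).testBit p = (decide (p / 4 < c) && (f (p / 4)).testBit (p % 4)) := by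
  induction c with
  | zero => simp [packF]
  | succ c ih =>
    simp only [packF, Nat.testBit_or, ih, Nat.testBit_shiftLeft]
    by_cases h1 : p / 4 < c
    · have hlt : p / 4 < c + 1 := by omega
      have hng : ¬ (p ≥ 4 * c) := by omega
      simp [h1, hlt, hng]
    · by_cases h2 : p / 4 = c
      · have hge : p ≥ 4 * c := by omega
        have hsub : p - 4 * c = p % 4 := by omega
        have hlt : p / 4 < c + 1 := by omega
        simp [h2, hge, hsub]
      · have hlt : ¬ p / 4 < c + 1 := by omega
        simp only [h1, hlt, decide_false, Bool.false_and, Bool.false_or]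
        by_cases hge : p ≥ 4 * c
        · have h4 : 4 ≤ p - 4 * c := by omega
          have h16 : 16 ≤ 2 ^ (p - 4 * c) := calc (16 : ℕ) = 2 ^ 4 := by norm_num
            _ ≤ 2 ^ (p - 4 * c) := Nat.pow_le_pow_right (by norm_num) h4
          simp [hge, Nat.testBit_lt_two_pow (lt_of_lt_of_le (hf c) h16)]
        · simp [hge]

/-- digits of `packF` -/
theorem dig_packF (f : ℕ → ℕ) (hf : ∀ t, f t < 16) {t : ℕ} (ht : t < 11) : dig (packF f 11) t = f t := by
  apply Nat.eq_of_testBit_eq; intro i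
  simp only [dig, Nat.testBit_and, Nat.testBit_shiftRight, testBit_packF f hf, testBit_fifteen]
  by_cases hi : i < 4
  · have h1 : (4 * t + i) / 4 = t := by omega
    have h2 : (4 * t + i) % 4 = i := by omega
    simp [hi, h1, h2, ht]
  · have h16 : 16 ≤ 2 ^ i := calc (16 : ℕ) = 2 ^ 4 := by norm_num
      _ ≤ 2 ^ i := Nat.pow_le_pow_right (by norm_num) (not_lt.1 hi)
    simp [hi, Nat.testBit_lt_two_pow (lt_of_lt_of_le (hf t) h16)]

/-- `packF` of small values is `< 2^44` -/
theorem packF_lt (f : ℕ → ℕ) (hf : ∀ t, f t < 16) : packF f 11 < 2 ^ 44 := by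
  apply Nat.lt_pow_two_of_testBit; intro i hi
  rw [testBit_packF f hf]
  have : ¬ i / 4 < 11 := by omega
  simp [this]

/-- `dig` of the packed map of data -/
theorem dig_packPhi (φ : Fin 11 → Fin 11) (t : Fin 11) : dig (packPhi φ) t.val = (φ t).val := packPhi_digit φ t

/-- two numbers `< 2^44` with the same eleven hex digits are equal -/
theorem eq_of_digits {a b : ℕ} (ha : a < 2 ^ 44) (hb : b < 2 ^ 44) (h : ∀ t, t < 11 → dig a t = dig b t) : a = b := by
  apply Nat.eq_of_testBit_eq; intro i
  by_cases hi : i < 44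
  · have h1 := congrArg (fun x => x.testBit (i % 4)) (h (i / 4) (by omega))
    simp only [dig, Nat.testBit_and, Nat.testBit_shiftRight, testBit_fifteen, Nat.mod_lt _ (show 0 < 4 by norm_num),
      decide_true, Bool.and_true] at h1
    have e : 4 * (i / 4) + i % 4 = i := by omega
    rwa [e] at h1
  · have h2 : 2 ^ 44 ≤ 2 ^ i := Nat.pow_le_pow_right (by norm_num) (by omega)
    rw [Nat.testBit_lt_two_pow (lt_of_lt_of_le ha h2), Nat.testBit_lt_two_pow (lt_of_lt_of_le hb h2)]

/-- the packed map is determined by its digits: criterion for `packPhi ψ = packF f 11` -/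
theorem packPhi_eq_packF (ψ : Fin 11 → Fin 11) (f : ℕ → ℕ) (hf : ∀ t, f t < 16) (h : ∀ t : Fin 11, (ψ t).val = f t.val) :
    packPhi ψ = packF f 11 :=
  eq_of_digits (packPhi_lt ψ) (packF_lt f hf) fun t ht => by
    rw [dig_packF f hf ht, ← h ⟨t, ht⟩, ← dig_packPhi]

variable (D : TriangleData 11)

/-! ### the four generator bridges -/

/-- `relabel` is `actT` on packed maps -/
theorem packPhi_relabel : packPhi D.relabel.phi = actT (packPhi D.phi) := by
  refine packPhi_eq_packF _ _ (fun t => by omega) fun t => ?_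
  rw [TriangleData.relabel_phi, val_sub11']
  have h1 : (t - 1 : Fin 11) = ⟨(t.val + 10) % 11, Nat.mod_lt _ (by norm_num)⟩ := by
    apply Fin.ext; rw [val_sub11']; simp
  rw [h1, ← dig_packPhi, ← dig_packPhi D.phi 10]
  rfl

/-- `scale` is `actM` on packed maps -/
theorem packPhi_scale : packPhi D.scale.phi = actM (packPhi D.phi) := by
  refine packPhi_eq_packF _ _ (fun t => by omega) fun t => ?_
  rw [TriangleData.scale_phi, Fin.val_mul]
  have h1 : (6 * t : Fin 11) = ⟨(6 * t.val) % 11, Nat.mod_lt _ (by norm_num)⟩ := by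
    apply Fin.ext; rw [Fin.val_mul]; rfl
  rw [h1, ← dig_packPhi]
  rfl

/-- `posOf` finds the (unique) position of a value of an injective map -/
theorem posOf_eq (φ : Fin 11 → Fin 11) (hinj : Injective φ) (s₀ : Fin 11) (v : ℕ) (hv : (φ s₀).val = v) :
    ∀ c, c ≤ 11 → 11 - c ≤ s₀.val → posOf (packPhi φ) v c = s₀.val
  | 0, _, h => by have := s₀.isLt; omega
  | c + 1, hc, h => by
    rw [posOf]
    by_cases hs : 10 - c = s₀.val
    · have : dig (packPhi φ) (10 - c) = v := by rw [hs, dig_packPhi, hv]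
      rw [if_pos (beq_iff_eq.2 this)]; exact hs
    · have hne : dig (packPhi φ) (10 - c) ≠ v := by
        intro e
        have hd := dig_packPhi φ ⟨10 - c, by omega⟩
        simp only at hd
        rw [hd, ← hv] at e
        exact hs (congrArg Fin.val (hinj (Fin.ext e)))
      rw [if_neg (by simpa [beq_iff_eq] using hne)]
      exact posOf_eq φ hinj s₀ v hv c (by omega) (by omega)

/-- `swap12` is `actI` on packed maps (for injective `φ`) -/
theorem packPhi_swap12 (hinj : Injective D.phi) : packPhi D.swap12.phi = actI (packPhi D.phi) := by
  have hpos : ∀ t : Fin 11, posOf (packPhi D.phi) t.val 11 = (D.swap12.phi t).val := fun t =>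
    posOf_eq D.phi hinj (D.swap12.phi t) t.val (by rw [D.phi_swap12_phi hinj]) 11 le_rfl (by simp)
  refine packPhi_eq_packF _ _ (fun t => ?_) fun t => (hpos t).symm
  by_cases ht : t < 11
  · rw [hpos ⟨t, ht⟩]; omega
  · -- out of range the value is irrelevant but still `≤ 11`
    suffices ∀ c, posOf (packPhi D.phi) t c ≤ 11 by exact lt_of_le_of_lt (this 11) (by norm_num)
    intro c; induction c with
    | zero => simp [posOf]
    | succ c ih => rw [posOf]; split_ifs <;> omega

/-- `swap01` is `actS` on packed maps -/
theorem packPhi_swap01 : packPhi D.swap01.phi = actS (packPhi D.phi) := by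
  refine packPhi_eq_packF _ _ (fun t => by omega) fun t => ?_
  rw [TriangleData.swap01_phi, Fin.val_add]
  have h1 : (-t : Fin 11) = ⟨(11 - t.val) % 11, Nat.mod_lt _ (by norm_num)⟩ := by
    apply Fin.ext
    have h := Fin.val_add t (-t)
    rw [add_neg_cancel] at h
    have := t.isLt; have := (-t).isLt
    simp only [Fin.val_zero] at h
    show (-t).val = (11 - t.val) % 11
    omega
  rw [h1, ← dig_packPhi]

/-! ### the word action on data -/

/-- one generator on data -/
noncomputable def actD (g : ℕ) (D : TriangleData 11) : TriangleData 11 :=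
  if g = 0 then D.relabel else if g = 1 then D.scale else if g = 2 then D.swap12 else D.swap01

/-- the word action on data (mirror of `applyW`) -/
noncomputable def applyWD : ℕ → TriangleData 11 → ℕ → TriangleData 11
  | _, D, 0 => D
  | w, D, f + 1 => if w < 2 then D else applyWD (w / 4) (actD (w % 4) D) f

/-- one generator preserves validity and `φ 0 = 0`, and acts on the packed map by `act` -/
theorem actD_spec (g : ℕ) (hg : g < 4) (hV : D.Valid) (h0 : D.phi 0 = 0) :
    (actD g D).Valid ∧ (actD g D).phi 0 = 0 ∧ packPhi (actD g D).phi = act g (packPhi D.phi) := by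
  have hinj : Injective D.phi := fun a b e => hV.1.1 a b e
  unfold actD act
  have hg' : g = 0 ∨ g = 1 ∨ g = 2 ∨ g = 3 := by omega
  rcases hg' with rfl | rfl | rfl | rfl
  · simpa using ⟨D.relabel_valid hV, D.relabel_phi_zero, packPhi_relabel D⟩
  · simpa using ⟨D.scale_valid hV, D.scale_phi_zero h0, packPhi_scale D⟩
  · simpa using ⟨D.swap12_valid hV, D.swap12_phi_zero hinj h0, packPhi_swap12 D hinj⟩
  · simpa using ⟨D.swap01_valid hV, D.swap01_phi_zero h0, packPhi_swap01 D⟩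

/-- **the word action**: validity and `φ 0 = 0` are preserved and the packed map follows `applyW` -/
theorem applyWD_spec : ∀ (f w : ℕ) (D : TriangleData 11), D.Valid → D.phi 0 = 0 →
    (applyWD w D f).Valid ∧ (applyWD w D f).phi 0 = 0 ∧ packPhi (applyWD w D f).phi = applyW w (packPhi D.phi) f
  | 0, w, D, hV, h0 => by simp [applyWD, applyW, hV, h0]
  | f + 1, w, D, hV, h0 => by
    rw [applyWD, applyW]
    by_cases hw : w < 2
    · simp [hw, hV, h0]
    · simp only [hw, if_false]
      obtain ⟨hV', h0', hP⟩ := actD_spec D (w % 4) (Nat.mod_lt _ (by norm_num)) hV h0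
      obtain ⟨a, b, c⟩ := applyWD_spec f (w / 4) _ hV' h0'
      exact ⟨a, b, by rw [c, hP]⟩

/-! ### the table check -/

/-- an entry of a checked slice is mapped to its representative by its word -/
theorem tabOK_sound {reps L : List ℕ} (h : tabOK reps L = true) {E : ℕ} (hE : E ∈ L) :
    applyW (E >>> 48) (E &&& 17592186044415) 20 = reps.getD ((E >>> 44) &&& 15) 0 := by
  unfold tabOK at h
  rw [List.all_eq_true] at h
  simpa using h E hE

/-! ### non-degeneracy -/

/-- a packed map equal to `0` is the zero map, which is not injective: so representatives index `< 11` is automatic -/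
theorem packPhi_ne_zero (φ : Fin 11 → Fin 11) (hinj : Injective φ) : packPhi φ ≠ 0 := fun h => by
  have d0 := dig_packPhi φ 0
  have d1 := dig_packPhi φ 1
  rw [h] at d0 d1
  simp [dig] at d0 d1
  exact absurd (hinj (Fin.ext (d0.symm.trans d1))) (by decide)

end Triangle12

end Summit.Ventures.DiscreteObjects.PP12
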